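import Literature.Geometry.Lorentzian.TwoParameterMaps
import Literature.Geometry.Lorentzian.CoordinateFrames
import Literature.Geometry.Lorentzian.CurvatureProofs
import Literature.Geometry.Lorentzian.HypersurfaceRestriction
import HarnessLib

/-!
# Fields along two-parameter maps in a chart: `Z_s` and `Z_{ts}` in coordinates

Infrastructure for the curvature identity `Z_{ts} − Z_{st} = R(x_t, x_s) Z` for vector fields on
two-parameter maps (O'Neill 1983, Ch. 4, Prop. 44 (2); carried out in a sequel file) and, through
it, for the Gauss equation and second-variation formulas. Continuing `TwoParameterMaps.lean`
(which treats the partial velocities `x_t`, `x_s` and proves `x_{ts} = x_{st}`), we consider an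
ARBITRARY field `Z` on a two-parameter map `x : ℝ → ℝ → M` — `Z t s ∈ T_{x(t,s)} M` with `C²`
lift `(t, s) ↦ (x(t,s), Z(t,s)) ∈ TM` — and compute its partial covariant derivatives (the
covariant derivatives `covariantDerivAlong` of `Geodesic.lean` along the parameter curves) in the
fibre coordinates `A = e₁|_y` of the trivialisation `e₁` of `TM` at a point `x₁` whose chart
domain contains `x(t, s)`, for any covariant derivative `cov` on `TM` with Christoffel data `Ĉᵢ`
reading `w ↦ ∇_w sᵢ` in `e₁` (`exists_contMDiffOn_christoffel` of `CoordinateFrames.lean`):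

* `continuousLinearMapAt_covariantDerivAlong_curry_right` — **`Z_s` in coordinates**:
  `A(D_s Z) = ∂_s Ẑ + ∑ᵢ Zⁱ Ĉᵢ(x) (∂_s x̂)` at `(t, s)`, with `Ẑ = A Z` the fibre coordinates
  (`Zⁱ = bⁱ(Ẑ)`) and `x̂ = φ ∘ x` the chart expression — O'Neill's
  `Z_v = ∑ₖ {∂Zᵏ/∂v + ∑ Γᵏᵢⱼ Zⁱ ∂xʲ/∂v} ∂ₖ` (1983, Ch. 4, p. 123, with Ch. 3, Prop. 3.18);
* `continuousLinearMapAt_covariantDerivAlong_covariantDerivAlong` — **`Z_{ts}` in coordinates**: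
  `A(D_t D_s Z) = ∂_t∂_s Ẑ + ∑ᵢ (∂_t Zⁱ Ĉᵢ(∂_s x̂) + Zⁱ (dĈᵢ(x_t))(∂_s x̂) + Zⁱ Ĉᵢ(∂_t∂_s x̂))
  + ∑ⱼ (A D_s Z)ʲ Ĉⱼ(∂_t x̂)` at `(t, s)` (for `Ĉᵢ` of class `C¹`), the `t`-derivative of the
  previous formula;
* the bookkeeping: the fibre coordinates `Ẑ` of a `C²` field and the chart expression `x̂` are
  `C²` maps `ℝ × ℝ → E` (`contDiffAt_trivializationAt_snd_uncurry`, `contDiffAt_extChartAt_uncurry'`),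
  the frame expansion `Z = ∑ bⁱ(A Z) sᵢ` near the parameter (`eventually_eq_sum_coord_smul_localFrame`,
  valid for every field along `x`), and the chain rule for vector-valued functions along curves
  (`hasDerivAt_comp_curve_vec`).

Both formulas are instances of the chart formula `continuousLinearMapAt_covariantDerivAlong_sum_smul`
of `CoordinateFrames.lean` (the induced covariant derivative of a frame combination), applied to
the frame expansions of `Z` along the `s`-curve and of `D_s Z` along the `t`-curve
(`covariantDerivAlong_congr_of_eventuallyEq`: `covariantDerivAlong` depends only on germs).
Everything is proved; there are no definitions and no named facts.

## References

* B. O'Neill, *Semi-Riemannian geometry with applications to relativity*, Academic Press 1983,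
  Ch. 3, Prop. 3.18 (induced covariant derivative, coordinate formula p. 66); Ch. 4, pp. 122–123
  (two-parameter maps, vector fields on them, `Z_v` in coordinates) and Prop. 4.44 (key
  `ONeill1983`).
-/

noncomputable section

open Bundle Set Filter VectorField Function
open scoped Manifold ContDiff Topology

namespace Literature.Geometry.Lorentzian

variable {E : Type*} [NormedAddCommGroup E] [NormedSpace ℝ E] {H : Type*} [TopologicalSpace H]
  {I : ModelWithCorners ℝ E H} {M : Type*} [TopologicalSpace M] [ChartedSpace H M]
  [IsManifold I ∞ M]

/-! ### Chain rule for vector-valued functions along curves -/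

omit [IsManifold I ∞ M] in
/-- Chain rule for a vector-valued function along a curve: `(Φ ∘ γ)'(t) = dΦ_{γ t}(γ' t)` for
`Φ : M → F` differentiable at `γ t` and `γ` differentiable at `t` (the real-valued case is
`hasDerivAt_comp_curve` of `GeodesicProofs.lean`). [folklore] -/
theorem hasDerivAt_comp_curve_vec {V : Type*} [NormedAddCommGroup V] [NormedSpace ℝ V]
    {γ : ℝ → M} {t : ℝ} {Φ : M → V}
    (hΦ : MDifferentiableAt I 𝓘(ℝ, V) Φ (γ t)) (hγ : MDifferentiableAt 𝓘(ℝ, ℝ) I γ t) :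
    HasDerivAt (fun t' ↦ Φ (γ t')) (mfderiv I 𝓘(ℝ, V) Φ (γ t) (velocity I γ t)) t := by
  have h₂ := hΦ.hasMFDerivAt.comp t hγ.hasMFDerivAt
  rw [hasMFDerivAt_iff_hasFDerivAt] at h₂
  set L : ℝ →L[ℝ] V := (mfderiv I 𝓘(ℝ, V) Φ (γ t)).comp (mfderiv 𝓘(ℝ, ℝ) I γ t) with hL
  have h₃ : HasFDerivAt (Φ ∘ γ) L t := h₂
  exact h₃.hasDerivAt

/-! ### The fibre coordinates of a `C²` field along a two-parameter map -/

section Coordinates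

variable {x : ℝ → ℝ → M} {Z : (t : ℝ) → (s : ℝ) → TangentSpace I (x t s)} {x₁ : M} {t s : ℝ}

/-- The fibre coordinate, in the trivialisation of `TM` at `x₁`, of a field `Z` along a
two-parameter map whose lift `(t, s) ↦ (x(t,s), Z(t,s)) ∈ TM` is `C^n` at a parameter `(t, s)`
with `x(t, s)` in the chart domain of `x₁`, is a `C^n` map `ℝ × ℝ → E` at `(t, s)` (the
coordinate functions `Zⁱ` of O'Neill 1983, Ch. 4, p. 122). [folklore] -/
theorem contDiffAt_trivializationAt_snd_uncurry (hsrc : x t s ∈ (chartAt H x₁).source)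
    (hZ : ContMDiffAt (𝓘(ℝ, ℝ).prod 𝓘(ℝ, ℝ)) I.tangent 2
      (fun q : ℝ × ℝ ↦ (TotalSpace.mk' E (x q.1 q.2) (Z q.1 q.2) : TangentBundle I M)) (t, s)) :
    ContDiffAt ℝ 2 (fun q : ℝ × ℝ ↦ (trivializationAt E (TangentSpace I : M → Type _) x₁
      (TotalSpace.mk' E (x q.1 q.2) (Z q.1 q.2) : TangentBundle I M)).2) (t, s) := by
  have : IsManifold I (2 + 1) M := inferInstanceAs (IsManifold I 3 M)
  have : ContMDiffVectorBundle 2 E (TangentSpace I : M → Type _) I :=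
    TangentBundle.contMDiffVectorBundle
  have he : (TotalSpace.mk' E (x t s) (Z t s) : TangentBundle I M) ∈
      (trivializationAt E (TangentSpace I : M → Type _) x₁).source := by
    rw [Trivialization.mem_source, TangentBundle.trivializationAt_baseSet]; exact hsrc
  have h1 : ContMDiffAt (𝓘(ℝ, ℝ).prod 𝓘(ℝ, ℝ)) 𝓘(ℝ, E) 2 (fun q : ℝ × ℝ ↦
      (trivializationAt E (TangentSpace I : M → Type _) x₁
        (TotalSpace.mk' E (x q.1 q.2) (Z q.1 q.2) : TangentBundle I M)).2) (t, s) :=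
    (((trivializationAt E (TangentSpace I : M → Type _) x₁).contMDiffAt_iff
      (f := fun q : ℝ × ℝ ↦ (TotalSpace.mk' E (x q.1 q.2) (Z q.1 q.2) : TangentBundle I M)) he).1 hZ).2
  have h2 : ContMDiffAt 𝓘(ℝ, ℝ × ℝ) 𝓘(ℝ, E) 2 (fun q : ℝ × ℝ ↦
      (trivializationAt E (TangentSpace I : M → Type _) x₁
        (TotalSpace.mk' E (x q.1 q.2) (Z q.1 q.2) : TangentBundle I M)).2) (t, s) := by
    rw [modelWithCornersSelf_prod, ← chartedSpaceSelf_prod]; exact h1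
  exact contMDiffAt_iff_contDiffAt.1 h2

omit [IsManifold I ∞ M] in
/-- The chart expression `(t, s) ↦ φ(x(t, s))`, `φ` the extended chart at `x₁`, of a two-parameter
map `C^n` at a parameter `(t, s)` with `x(t, s)` in the chart domain of `x₁`, is `C^n` at `(t, s)`
(as `contDiffAt_extChartAt_uncurry` of `TwoParameterMaps.lean`, for an arbitrary chart).
[folklore] -/
theorem contDiffAt_extChartAt_uncurry' {n : ℕ∞ω} [IsManifold I n M]
    (hsrc : x t s ∈ (chartAt H x₁).source)
    (hx : ContMDiffAt (𝓘(ℝ, ℝ).prod 𝓘(ℝ, ℝ)) I n (uncurry x) (t, s)) :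
    ContDiffAt ℝ n (fun q : ℝ × ℝ ↦ extChartAt I x₁ (x q.1 q.2)) (t, s) := by
  have h1 : ContMDiffAt 𝓘(ℝ, ℝ × ℝ) I n (uncurry x) (t, s) := by
    rw [modelWithCornersSelf_prod, ← chartedSpaceSelf_prod]; exact hx
  have h0 : ContMDiffAt I 𝓘(ℝ, E) n (extChartAt I x₁) (uncurry x (t, s)) :=
    contMDiffAt_extChartAt' hsrc
  exact contMDiffAt_iff_contDiffAt.1 (h0.comp (t, s) h1)

/-- **A field along a two-parameter map expanded in the coordinate frame**: near a parameter
`(t, s)` with `x(t, s)` in the chart domain of `x₁`, `Z(t', s') = ∑ⱼ Zʲ(t', s') sⱼ(x(t', s'))`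
with `Zʲ = bʲ ∘ (e₁ Z)` the fibre coordinates in the trivialisation `e₁` at `x₁` and `sⱼ` its local
frame (Mathlib's `eq_sum_localFrame_coeff_smul`). O'Neill 1983, Ch. 4, p. 122 (`Z = ∑ Zⁱ ∂ᵢ`).
[folklore] -/
theorem eventually_eq_sum_coord_smul_localFrame {n : ℕ∞ω} {ι : Type*} [Fintype ι]
    (b : Module.Basis ι ℝ E) (hsrc : x t s ∈ (chartAt H x₁).source)
    (hx : ContMDiffAt (𝓘(ℝ, ℝ).prod 𝓘(ℝ, ℝ)) I n (uncurry x) (t, s)) :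
    ∀ᶠ q : ℝ × ℝ in 𝓝 (t, s), Z q.1 q.2 =
      ∑ j, b.coord j ((trivializationAt E (TangentSpace I : M → Type _) x₁
          (TotalSpace.mk' E (x q.1 q.2) (Z q.1 q.2) : TangentBundle I M)).2) •
        (trivializationAt E (TangentSpace I : M → Type _) x₁).localFrame b j (x q.1 q.2) := by
  have hev : ∀ᶠ q : ℝ × ℝ in 𝓝 (t, s), x q.1 q.2 ∈ (chartAt H x₁).source :=
    hx.continuousAt.preimage_mem_nhds ((chartAt H x₁).open_source.mem_nhds hsrc)
  filter_upwards [hev] with q hq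
  have hqe : x q.1 q.2 ∈ (trivializationAt E (TangentSpace I : M → Type _) x₁).baseSet := by
    simpa using hq
  have h := (trivializationAt E (TangentSpace I : M → Type _) x₁).eq_sum_localFrame_coeff_smul
    (I := I) (b := b) (s := fun _ ↦ Z q.1 q.2) hqe
  simp only [(trivializationAt E (TangentSpace I : M → Type _) x₁).localFrame_coeff_eq_coeff
    (b := b) (s := fun _ ↦ Z q.1 q.2) hqe] at h
  simp only [Module.Basis.coord_apply]
  exact h

variable [FiniteDimensional ℝ E] (cov : CovariantDerivative I E (TangentSpace I : M → Type _))

/-- **The partial covariant derivative `D_s Z` of a field along a two-parameter map, in the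
chart.** Let `e₁` be the trivialisation of `TM` at `x₁` (fibre coordinate map `A = e₁|_y`), `sᵢ`
its local frame for a basis `b`, and `Ĉᵢ` Christoffel data reading `w ↦ ∇_w sᵢ` in `e₁` on the chart
domain of `x₁` (`exists_contMDiffOn_christoffel`). For a two-parameter map `x` and a field `Z`
along it, both `C²` at a parameter `(t, s)` with `x(t, s)` in the chart domain, the covariant
derivative at `s` of `s' ↦ Z(t, s')` along the parameter curve `s' ↦ x(t, s')` reads
`A(D_s Z) = ∂_s Ẑ + ∑ᵢ Zⁱ Ĉᵢ(x(t,s)) (∂_s x̂)`, where `Ẑ = A Z` (fibre coordinates, `Zⁱ = bⁱ(Ẑ)`)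
and `x̂ = φ ∘ x` is the chart expression: O'Neill's coordinate formula
`Z_v = ∑ₖ {∂Zᵏ/∂v + ∑ᵢⱼ Γᵏᵢⱼ Zⁱ ∂xʲ/∂v} ∂ₖ` (1983, Ch. 4, p. 123, with Ch. 3, Prop. 3.18), via the
chart formula `continuousLinearMapAt_covariantDerivAlong_sum_smul` for the frame expansion
`Z = ∑ Zʲ sⱼ`. [cite: ONeill1983, Ch. 4, p. 123 and Ch. 3, Prop. 3.18] -/
theorem continuousLinearMapAt_covariantDerivAlong_curry_right {ι : Type*} [Fintype ι]
    (b : Module.Basis ι ℝ E) (Ĉ : ι → M → (E →L[ℝ] E))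
    (hĈ : ∀ y ∈ (chartAt H x₁).source, ∀ (i) (w : TangentSpace I y),
      Ĉ i y ((trivializationAt E (TangentSpace I) x₁).continuousLinearMapAt ℝ y w) =
        (trivializationAt E (TangentSpace I) x₁
          ⟨y, cov ((trivializationAt E (TangentSpace I) x₁).localFrame b i) y w⟩).2)
    (hsrc : x t s ∈ (chartAt H x₁).source)
    (hx : ContMDiffAt (𝓘(ℝ, ℝ).prod 𝓘(ℝ, ℝ)) I 2 (uncurry x) (t, s))
    (hZ : ContMDiffAt (𝓘(ℝ, ℝ).prod 𝓘(ℝ, ℝ)) I.tangent 2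
      (fun q : ℝ × ℝ ↦ (TotalSpace.mk' E (x q.1 q.2) (Z q.1 q.2) : TangentBundle I M)) (t, s)) :
    (trivializationAt E (TangentSpace I) x₁).continuousLinearMapAt ℝ (x t s)
        (covariantDerivAlong cov (x t) (Z t) s) =
      deriv (fun s' ↦ (trivializationAt E (TangentSpace I : M → Type _) x₁
          (TotalSpace.mk' E (x t s') (Z t s') : TangentBundle I M)).2) s
      + ∑ i, b.coord i ((trivializationAt E (TangentSpace I : M → Type _) x₁
          (TotalSpace.mk' E (x t s) (Z t s) : TangentBundle I M)).2) •
        Ĉ i (x t s) (deriv (fun s' ↦ extChartAt I x₁ (x t s')) s) := by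
  -- notation: the fibre coordinates `Ẑ` and the coefficient functions `s' ↦ Zⁱ(t, s')`
  set zc : ℝ × ℝ → E := fun q ↦ (trivializationAt E (TangentSpace I : M → Type _) x₁
    (TotalSpace.mk' E (x q.1 q.2) (Z q.1 q.2) : TangentBundle I M)).2 with hzc
  have hzc2 : ContDiffAt ℝ 2 zc (t, s) := contDiffAt_trivializationAt_snd_uncurry hsrc hZ
  have hl : HasDerivAt (fun s' : ℝ ↦ ((t, s') : ℝ × ℝ)) ((0 : ℝ), (1 : ℝ)) s := by
    simpa using (hasDerivAt_const s t).prodMk (hasDerivAt_id s)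
  have hzcs : HasDerivAt (fun s' ↦ zc (t, s')) (fderiv ℝ zc (t, s) (0, 1)) s :=
    (hzc2.differentiableAt (by norm_num)).hasFDerivAt.comp_hasDerivAt s hl
  have hc : ∀ i, HasDerivAt (fun s' ↦ b.coord i (zc (t, s'))) (b.coord i (fderiv ℝ zc (t, s) (0, 1))) s :=
    fun i ↦ ((b.coord i).toContinuousLinearMap).hasFDerivAt.comp_hasDerivAt s hzcs
  -- the field along the `s`-curve is the frame combination `∑ Zʲ sⱼ` near `s`
  have hl' : Tendsto (fun s' : ℝ ↦ ((t, s') : ℝ × ℝ)) (𝓝 s) (𝓝 (t, s)) :=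
    (continuous_const.prodMk continuous_id).tendsto s
  have hgerm : (fun s' ↦ (TotalSpace.mk' E (x t s') (∑ j, b.coord j (zc (t, s')) •
      (trivializationAt E (TangentSpace I : M → Type _) x₁).localFrame b j (x t s')) :
        TangentBundle I M)) =ᶠ[𝓝 s]
      fun s' ↦ (TotalSpace.mk' E (x t s') (Z t s') : TangentBundle I M) := by
    filter_upwards [hl'.eventually (eventually_eq_sum_coord_smul_localFrame (Z := Z) b hsrc hx)]
      with s' hs'
    rw [← hs']
  rw [← covariantDerivAlong_congr_of_eventuallyEq cov hgerm]
  -- the chart formula for the covariant derivative of a frame combination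
  rw [continuousLinearMapAt_covariantDerivAlong_sum_smul cov b (N := (chartAt H x₁).source)
    subset_rfl Ĉ hĈ (γ := x t) hsrc (mdifferentiableAt_curry_right hx two_ne_zero)
    (fun i ↦ (hc i).differentiableAt)]
  -- `∑ (Zⁱ)' bᵢ = ∂_s Ẑ` and `A x_s = ∂_s x̂`
  congr 1
  · rw [hzcs.deriv]
    have hderiv : ∀ i, deriv (fun s' ↦ b.coord i (zc (t, s'))) s • b i =
        b.coord i (fderiv ℝ zc (t, s) (0, 1)) • b i := fun i ↦ by rw [(hc i).deriv]
    rw [Finset.sum_congr rfl (fun i _ ↦ hderiv i)]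
    simp only [Module.Basis.coord_apply]
    exact b.sum_repr _
  · simp only [trivializationAt_velocity_curry_right (mdifferentiableAt_curry_right hx two_ne_zero)
      hsrc]
    rfl

/-- **The iterated partial covariant derivative `D_t D_s Z` in the chart.** In the setting of
`continuousLinearMapAt_covariantDerivAlong_curry_right` (with, in addition, the Christoffel data
`Ĉᵢ` of class `C¹` on the chart domain): the covariant derivative at `t`, along the `t`-parameter
curve `t' ↦ x(t', s)`, of the field `t' ↦ D_s Z (t', s)` reads, in the fibre coordinates at `x₁`,
`A(D_t D_s Z) = ∂_t∂_s Ẑ + ∑ᵢ (∂_t Zⁱ Ĉᵢ(x̂_s) + Zⁱ (dĈᵢ(x_t))(x̂_s) + Zⁱ Ĉᵢ(∂_t x̂_s))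
  + ∑ⱼ (Y_s)ʲ Ĉⱼ(x̂_t)` with `Y_s = ∂_s Ẑ + ∑ᵢ Zⁱ Ĉᵢ(x̂_s)` (`= A(D_s Z)`), all at `(t, s)` — the
`t`-derivative of O'Neill's coordinate formula for `Z_v` (1983, Ch. 4, p. 123) computed by the
chart formula `continuousLinearMapAt_covariantDerivAlong_sum_smul` once more.
[cite: ONeill1983, Ch. 4, p. 123 and Ch. 3, Prop. 3.18] -/
theorem continuousLinearMapAt_covariantDerivAlong_covariantDerivAlong {ι : Type*} [Fintype ι]
    (b : Module.Basis ι ℝ E) (Ĉ : ι → M → (E →L[ℝ] E))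
    (hĈ : ∀ y ∈ (chartAt H x₁).source, ∀ (i) (w : TangentSpace I y),
      Ĉ i y ((trivializationAt E (TangentSpace I) x₁).continuousLinearMapAt ℝ y w) =
        (trivializationAt E (TangentSpace I) x₁
          ⟨y, cov ((trivializationAt E (TangentSpace I) x₁).localFrame b i) y w⟩).2)
    (hĈs : ∀ i, ContMDiffOn I 𝓘(ℝ, E →L[ℝ] E) 1 (Ĉ i) (chartAt H x₁).source)
    (hsrc : x t s ∈ (chartAt H x₁).source)
    (hx : ContMDiffAt (𝓘(ℝ, ℝ).prod 𝓘(ℝ, ℝ)) I 2 (uncurry x) (t, s))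
    (hZ : ContMDiffAt (𝓘(ℝ, ℝ).prod 𝓘(ℝ, ℝ)) I.tangent 2
      (fun q : ℝ × ℝ ↦ (TotalSpace.mk' E (x q.1 q.2) (Z q.1 q.2) : TangentBundle I M)) (t, s)) :
    (trivializationAt E (TangentSpace I) x₁).continuousLinearMapAt ℝ (x t s)
        (covariantDerivAlong cov (fun t' ↦ x t' s)
          (fun t' ↦ covariantDerivAlong cov (x t') (Z t') s) t) =
      (fderiv ℝ (fderiv ℝ (fun q : ℝ × ℝ ↦ (trivializationAt E (TangentSpace I : M → Type _) x₁
          (TotalSpace.mk' E (x q.1 q.2) (Z q.1 q.2) : TangentBundle I M)).2)) (t, s) (1, 0) (0, 1)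
        + ∑ i, (b.coord i (fderiv ℝ (fun q : ℝ × ℝ ↦ (trivializationAt E (TangentSpace I : M → Type _) x₁
              (TotalSpace.mk' E (x q.1 q.2) (Z q.1 q.2) : TangentBundle I M)).2) (t, s) (1, 0)) •
            Ĉ i (x t s) (deriv (fun s' ↦ extChartAt I x₁ (x t s')) s)
          + b.coord i ((trivializationAt E (TangentSpace I : M → Type _) x₁
              (TotalSpace.mk' E (x t s) (Z t s) : TangentBundle I M)).2) •
            (show E →L[ℝ] E from
              mfderiv I 𝓘(ℝ, E →L[ℝ] E) (Ĉ i) (x t s) (velocity I (fun t' ↦ x t' s) t))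
              (deriv (fun s' ↦ extChartAt I x₁ (x t s')) s)
          + b.coord i ((trivializationAt E (TangentSpace I : M → Type _) x₁
              (TotalSpace.mk' E (x t s) (Z t s) : TangentBundle I M)).2) •
            Ĉ i (x t s) (fderiv ℝ (fderiv ℝ (fun q : ℝ × ℝ ↦ extChartAt I x₁ (x q.1 q.2))) (t, s)
              (1, 0) (0, 1))))
      + ∑ j, b.coord j (deriv (fun s' ↦ (trivializationAt E (TangentSpace I : M → Type _) x₁
            (TotalSpace.mk' E (x t s') (Z t s') : TangentBundle I M)).2) s
          + ∑ i, b.coord i ((trivializationAt E (TangentSpace I : M → Type _) x₁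
              (TotalSpace.mk' E (x t s) (Z t s) : TangentBundle I M)).2) •
            Ĉ i (x t s) (deriv (fun s' ↦ extChartAt I x₁ (x t s')) s)) •
        Ĉ j (x t s) (deriv (fun t' ↦ extChartAt I x₁ (x t' s)) t) := by
  -- notation
  set zc : ℝ × ℝ → E := fun q ↦ ((trivializationAt E (TangentSpace I : M → Type _) x₁) (TotalSpace.mk' E (x q.1 q.2) (Z q.1 q.2) : TangentBundle I M)).2
    with hzc
  set X : ℝ × ℝ → E := fun q ↦ extChartAt I x₁ (x q.1 q.2) with hX
  set Z' : (t' : ℝ) → (s' : ℝ) → TangentSpace I (x t' s') :=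
    fun t' s' ↦ covariantDerivAlong cov (x t') (Z t') s' with hZ'
  -- the coordinate formula for `D_s Z` holds near `(t, s)`; restrict it to the `t`-line
  have hev2 : ∀ᶠ q : ℝ × ℝ in 𝓝 (t, s), ContMDiffAt (𝓘(ℝ, ℝ).prod 𝓘(ℝ, ℝ)) I 2 (uncurry x) q ∧
      ContMDiffAt (𝓘(ℝ, ℝ).prod 𝓘(ℝ, ℝ)) I.tangent 2
        (fun q : ℝ × ℝ ↦ (TotalSpace.mk' E (x q.1 q.2) (Z q.1 q.2) : TangentBundle I M)) q ∧
      x q.1 q.2 ∈ (chartAt H x₁).source := by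
    refine ((contMDiffAt_iff_contMDiffAt_nhds (by decide)).1 hx).and
      ((((contMDiffAt_iff_contMDiffAt_nhds (by decide)).1 hZ)).and ?_)
    exact hx.continuousAt.preimage_mem_nhds ((chartAt H x₁).open_source.mem_nhds hsrc)
  have hl : Tendsto (fun t' : ℝ ↦ ((t', s) : ℝ × ℝ)) (𝓝 t) (𝓝 (t, s)) :=
    (continuous_id.prodMk continuous_const).tendsto t
  -- `Φ t'`: the coordinates of `D_s Z (t', s)` for `t'` near `t`
  set Φ : ℝ → E := fun t' ↦ deriv (fun s' ↦ zc (t', s')) s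
    + ∑ i, b.coord i (zc (t', s)) • Ĉ i (x t' s) (deriv (fun s' ↦ X (t', s')) s) with hΦ
  have hΦeq : ∀ᶠ t' in 𝓝 t, (trivializationAt E (TangentSpace I : M → Type _) x₁).continuousLinearMapAt ℝ (x t' s) (Z' t' s) = Φ t' := by
    filter_upwards [hl.eventually hev2] with t' ht'
    exact continuousLinearMapAt_covariantDerivAlong_curry_right cov b Ĉ hĈ ht'.2.2 ht'.1 ht'.2.1
  -- the field `t' ↦ D_s Z (t', s)` is the frame combination with coefficients `bʲ(Φ t')` near `t`
  have hsrc_t : ∀ᶠ t' in 𝓝 t, x t' s ∈ (chartAt H x₁).source := (hl.eventually hev2).mono fun _ h ↦ h.2.2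
  have hgerm : (fun t' ↦ (TotalSpace.mk' E (x t' s) (∑ j, b.coord j (Φ t') •
      (trivializationAt E (TangentSpace I : M → Type _) x₁).localFrame b j (x t' s)) :
        TangentBundle I M)) =ᶠ[𝓝 t]
      fun t' ↦ (TotalSpace.mk' E (x t' s) (Z' t' s) : TangentBundle I M) := by
    filter_upwards [hΦeq, hsrc_t] with t' ht' hts
    have hte : x t' s ∈ (trivializationAt E (TangentSpace I : M → Type _) x₁).baseSet := by
      simpa using hts
    have hexp := (trivializationAt E (TangentSpace I : M → Type _) x₁).eq_sum_localFrame_coeff_smul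
      (I := I) (b := b) (s := fun _ ↦ Z' t' s) hte
    simp only [(trivializationAt E (TangentSpace I : M → Type _) x₁).localFrame_coeff_eq_coeff
      (b := b) (s := fun _ ↦ Z' t' s) hte] at hexp
    rw [← Trivialization.continuousLinearMapAt_apply_of_mem ℝ _ hte, ht'] at hexp
    simp only [Module.Basis.coord_apply]
    rw [← hexp]
  -- derivatives of the ingredients of `Φ` at `t`
  have hzc2 : ContDiffAt ℝ 2 zc (t, s) := contDiffAt_trivializationAt_snd_uncurry hsrc hZ
  have hX2 : ContDiffAt ℝ 2 X (t, s) := contDiffAt_extChartAt_uncurry' hsrc hx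
  have hzc_ts := (deriv_deriv_comm_of_contDiffAt hzc2).1
  have hX_ts := (deriv_deriv_comm_of_contDiffAt hX2).1
  have hlt : HasDerivAt (fun t' : ℝ ↦ ((t', s) : ℝ × ℝ)) ((1 : ℝ), (0 : ℝ)) t := by
    simpa using (hasDerivAt_id t).prodMk (hasDerivAt_const t s)
  have hzc_t : HasDerivAt (fun t' ↦ zc (t', s)) (fderiv ℝ zc (t, s) (1, 0)) t := by
    have h := (hzc2.differentiableAt (by norm_num)).hasFDerivAt.comp_hasDerivAt t hlt
    exact h
  have hcoef : ∀ i, HasDerivAt (fun t' ↦ b.coord i (zc (t', s)))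
      (b.coord i (fderiv ℝ zc (t, s) (1, 0))) t :=
    fun i ↦ ((b.coord i).toContinuousLinearMap).hasFDerivAt.comp_hasDerivAt t hzc_t
  have hcurve : MDifferentiableAt 𝓘(ℝ, ℝ) I (fun t' ↦ x t' s) t := mdifferentiableAt_curry_left hx two_ne_zero
  have hC : ∀ i, HasDerivAt (fun t' ↦ Ĉ i (x t' s))
      (show E →L[ℝ] E from
        mfderiv I 𝓘(ℝ, E →L[ℝ] E) (Ĉ i) (x t s) (velocity I (fun t' ↦ x t' s) t)) t := fun i ↦
    hasDerivAt_comp_curve_vec (((hĈs i).contMDiffAt ((chartAt H x₁).open_source.mem_nhds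
      hsrc)).mdifferentiableAt one_ne_zero) hcurve
  have hΦ' : HasDerivAt Φ (fderiv ℝ (fderiv ℝ zc) (t, s) (1, 0) (0, 1)
      + ∑ i, (b.coord i (fderiv ℝ zc (t, s) (1, 0)) • Ĉ i (x t s) (deriv (fun s' ↦ X (t, s')) s)
        + b.coord i (zc (t, s)) •
          (show E →L[ℝ] E from
            mfderiv I 𝓘(ℝ, E →L[ℝ] E) (Ĉ i) (x t s) (velocity I (fun t' ↦ x t' s) t))
            (deriv (fun s' ↦ X (t, s')) s)
        + b.coord i (zc (t, s)) • Ĉ i (x t s) (fderiv ℝ (fderiv ℝ X) (t, s) (1, 0) (0, 1)))) t := by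
    refine hzc_ts.add (HasDerivAt.fun_sum fun i _ ↦ ?_)
    have h := (hcoef i).smul ((hC i).clm_apply hX_ts)
    convert h using 1
    · funext t'
      rfl
    · rw [smul_add]
      abel
  -- the chart formula for `D_t` of the frame combination `∑ bʲ(Φ) sⱼ`
  have hcj : ∀ j, HasDerivAt (fun t' ↦ b.coord j (Φ t'))
      (b.coord j (fderiv ℝ (fderiv ℝ zc) (t, s) (1, 0) (0, 1)
      + ∑ i, (b.coord i (fderiv ℝ zc (t, s) (1, 0)) • Ĉ i (x t s) (deriv (fun s' ↦ X (t, s')) s)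
        + b.coord i (zc (t, s)) •
          (show E →L[ℝ] E from
            mfderiv I 𝓘(ℝ, E →L[ℝ] E) (Ĉ i) (x t s) (velocity I (fun t' ↦ x t' s) t))
            (deriv (fun s' ↦ X (t, s')) s)
        + b.coord i (zc (t, s)) • Ĉ i (x t s) (fderiv ℝ (fderiv ℝ X) (t, s) (1, 0) (0, 1))))) t :=
    fun j ↦ ((b.coord j).toContinuousLinearMap).hasFDerivAt.comp_hasDerivAt t hΦ'
  rw [← covariantDerivAlong_congr_of_eventuallyEq cov hgerm,
    continuousLinearMapAt_covariantDerivAlong_sum_smul cov b (N := (chartAt H x₁).source)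
      subset_rfl Ĉ hĈ (γ := fun t' ↦ x t' s) hsrc hcurve (fun j ↦ (hcj j).differentiableAt),
    trivializationAt_velocity_curry_left hcurve hsrc]
  congr 1
  rw [Finset.sum_congr rfl (fun j _ ↦ by rw [(hcj j).deriv])]
  simp only [Module.Basis.coord_apply]
  exact b.sum_repr _

end Coordinates

end Literature.Geometry.Lorentzian

end
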